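import Summits.ResolutionOfSingularities.ResolutionOfSingularities.Theorems.PurelyInseparableDim4Perm2Bound
import Literature.AlgebraicGeometry.Resolution.PointBlowupMohBoundPrimePower
import Literature.AlgebraicGeometry.Resolution.CentreBlowupResidueInequality
import HarnessLib

/-!
# [OURS · res-dim4-pi PR-2, part 3] Translated points: the transfer without condition (2),
  `d′ ≤ 2d − g + p^{e−1}` at every point over the origin of a Hironaka-permissible centre, and
  «loss-free ⇒ no rise» / «loss-free PERM2-0 ⇒ `d′ ≤ 2d − g`» at EVERY `q = p^e`

Cell `res-dim4-pi` (D-0157 DOOR 2), brick **PR-2**, seat `res-dim4-p-2`; part 3 (parts 1–2: the chart-origin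
law and `d′ ≤ 2d − g` at `t = 0`; crit-1 T-A-02 asked that PERM2-0 rises at TRANSLATED points be «triaged
individually» — this file bounds them). Notation of parts 1–2 (`F = x^r·G` clean, `d = ord₀ F − |r|`, centre
`V(z, x_S)` with condition (1) ONLY, `j ∈ S`, `g = ordAlong S F − degIn S r ≤ d`); `b` is ANY point of the
`x_j`-chart over the origin of the centre (`b_j = 0`, `b_i = 0` for `i ∉ S`; `x_i` with `b_i ≠ 0` LOST).

## What is proved
* §4.1 `step_r_le_of_mem_support_step` (`x^{r′} ∣ F′` WITHOUT condition (2)), `degree_step_r_transfer`.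
* §4.2 **`shade_step_add_le_shade_pointStep_add`** — THE TRANSFER WITHOUT (2), every `q`:
  `d′(centre S) + g ≤ d′(POINT blow-up, same chart and point) + d` (`g = d`: the tree's
  `shade_step_le_shade_pointStep`).
* §4.3 (`q = p^e`, `e ≥ 1`, `char K = p`): **`shade_step_add_le_two_mul_add_pow` : `d′ ≤ 2d − g + p^{e−1}`**
  at every point over the origin of a Hironaka-permissible centre (with (2) it is the tree's
  `CentreBlowup.mohBound_pow`, not restated); **`shade_step_add_le_two_mul_of_lossFree` : `d′ ≤ 2d − g` on
  LOSS-FREE edges** (`r_i ≠ 0 ⇒ b_i = 0`), every `e` — part 2's origin bound at every loss-free point;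
  **`shade_step_le_of_lossFree_pow` : (1) ∧ (2) ∧ loss-free ⇒ `d′ ≤ d` at EVERY `e ≥ 1`** (part 2: `e = 1`),
  from the tree's `CentreBlowup.exists_two_lost_of_shadeIncreases` [HP19 PRIMS comment (d)].
* §4.4 cell words: `shade_add_ordAlong_le_add_pow`, `shade_le_add_pow_of_perm2` (via `mohBound_pow`),
  `shade_add_ordAlong_le_of_lossFree`, `not_riseD_of_perm2_of_lossFree_pow`.

## What is NOT proved (honest scope)
Points moving ALONG the centre (`b_i ≠ 0`, `i ∉ S`) are brick PR-1; cleaning = the model's perfect-field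
deletion of `q`-th-power monomials. [OURS · counted 0 · AI work weaker than expert review] NOTHING here proves
resolution of singularities in dimension ≥ 4 / characteristic `p`; bounds on the letter `d` of OUR candidate
frame (MODE 1h coordinate game), census value. bears_on: LADDER-RESOLUTION:D157-DOOR2 (res-dim4-pi · PR-2).
Supports stmt-ResolutionOfSingularities-16155 (helper).
-/

noncomputable section

set_option linter.dupNamespace false -- mandated namespace of this single-conjunct summit
open MvPolynomial Finset
open scoped BigOperators

namespace Summit.ResolutionOfSingularities.ResolutionOfSingularities.Theorems.PIDim4
namespace Perm2Bound
open Literature.AlgebraicGeometry.Resolution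
open Literature.AlgebraicGeometry.Resolution.CentreBlowup
open Literature.AlgebraicGeometry.Resolution.Hauser2010
open Literature.Barriers.ResolutionOfSingularities (ordZero_le_of_coeff_ne_zero le_ordZero_of_forall)

section Transfer
variable {σ : Type*} {K : Type*} [Field K] [Fintype σ] [DecidableEq σ] [DecidableEq K]

/-! ### §4.1 The new exceptional monomial divides the new residual polynomial — no condition (2) -/

/-- **`x^{r′} ∣ F′` after ANY coordinate-centre step** (chart `x_j`, `b_j = 0`, any point, any `q`) for a
state with `x^r ∣ F` — the tree's `CentreBlowup.newMult_le_of_mem_support_step` without condition (2). [folklore] -/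
theorem step_r_le_of_mem_support_step (q : ℕ) (S : Finset σ) (j : σ) (b : σ → K) (hbj : b j = 0)
    (s : CState σ K) (hr : ∀ d ∈ s.F.support, s.r ≤ d) :
    ∀ E ∈ (step q S j b s).F.support, (step q S j b s).r ≤ E := by
  intro E hE
  have hE' : coeff E (pointTransform q S j b s) ≠ 0 := by
    have h := MvPolynomial.mem_support_iff.mp hE
    change coeff E (deletePthPowers q (pointTransform q S j b s)) ≠ 0 at h
    rw [coeff_deletePthPowers] at h
    split_ifs at h with hP
    · exact (h rfl).elim
    · exact h
  rw [pointTransform_eq_sum, coeff_sum] at hE'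
  obtain ⟨d, hd, hne⟩ := Finset.exists_ne_zero_of_sum_ne_zero hE'
  show newMult q S j b s ≤ E
  rw [Finsupp.le_def]
  intro i
  unfold newMult
  rw [Finsupp.update_apply]
  by_cases hij : i = j
  · rw [if_pos hij, hij]
    have heq : E j = chartExponent q S j d j :=
      PointBlowup.apply_eq_of_coeff_translate_monomial_ne_zero b hbj hne
    rw [heq, chartExponent_apply_self]
    have h1 : (ordAlong S s.F).toNat ≤ degIn S d :=
      ENat.toNat_le_of_le_coe (ordAlong_le_of_mem_support hd)
    omega
  · rw [if_neg hij, Finsupp.filter_apply]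
    by_cases hbi : b i = 0
    · rw [if_pos hbi]
      have heq : E i = chartExponent q S j d i :=
        PointBlowup.apply_eq_of_coeff_translate_monomial_ne_zero b hbi hne
      rw [heq, chartExponent_apply_of_ne q S hij]
      exact Finsupp.le_def.mp (hr d hd) i
    · rw [if_neg hbi]
      exact Nat.zero_le _

/-- **The two new multiplicity vectors** (centre vs. point step, same chart and point, `b_j = 0`):
`|r′_point| + degIn S r + g = |r′_centre| + o` (they differ only at `j`: `o − q` vs. `degIn S r + g − q`),
and the centre step keeps `r_i` at every untranslated `i ≠ j`. [folklore] -/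
theorem degree_step_r_transfer {q : ℕ} {S : Finset σ} {j : σ} (b : σ → K)
    (hbj : b j = 0) (s : CState σ K) {o : ℕ} (ho : ordZero s.F = o)
    (hr : ∀ d ∈ s.F.support, s.r ≤ d) (hq : ∀ d ∈ s.F.support, q ≤ degIn S d) {g : ℕ}
    (hg : ordAlong S s.F = ((degIn S s.r + g : ℕ) : ℕ∞)) :
    (PointBlowup.step q j b s.toState).r.degree + degIn S s.r + g = (step q S j b s).r.degree + o ∧
      ∀ i, i ≠ j → b i = 0 → (step q S j b s).r i = s.r i := by
  obtain ⟨⟨d₀, hd₀, hd₀deg⟩, -⟩ := (ordZero_eq_nat_iff _ _).mp ho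
  have hd₀s : d₀ ∈ s.F.support := MvPolynomial.mem_support_iff.mpr hd₀
  have halong : degIn S s.r + g ≤ degIn S d₀ := by
    have := ordAlong_le_of_mem_support (S := S) hd₀s
    rw [hg] at this
    exact_mod_cast this
  have hgo : degIn S s.r + g ≤ o := by
    have h1 := degIn_sub_le_degree_sub S (hr d₀ hd₀s)
    have h2 : s.r.degree ≤ o := hd₀deg ▸ PointBlowup.degree_le_degree_of_le (hr d₀ hd₀s)
    have h3 := degIn_le_degree S s.r
    omega
  have hqS : q ≤ degIn S s.r + g := by
    obtain ⟨d₁, hd₁, hd₁eq⟩ := exists_mem_support_ordAlong_eq S (ne_zero_of_ordZero_eq_natCast ho)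
    have h1 := hq d₁ hd₁
    rw [hg] at hd₁eq
    have h2 : degIn S s.r + g = degIn S d₁ := by exact_mod_cast hd₁eq
    omega
  have hcen : (step q S j b s).r = (s.r.filter fun i => b i = 0).update j (degIn S s.r + g - q) := by
    show newMult q S j b s = _
    unfold newMult
    rw [hg, ENat.toNat_coe]
  have hpt : (PointBlowup.step q j b s.toState).r =
      (s.r.filter fun i => b i = 0).update j (o - q) := by
    show PointBlowup.newMult q j b s.toState = _
    rw [PointBlowup.newMult_eq q j b hbj s.toState ho]
    exact PointBlowup.filter_update_of_pos s.r (Z := fun i => b i = 0) hbj (o - q)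
  have k1 := PointBlowup.degree_update_add (s.r.filter fun i => b i = 0) j (degIn S s.r + g - q)
  have k2 := PointBlowup.degree_update_add (s.r.filter fun i => b i = 0) j (o - q)
  refine ⟨?_, ?_⟩
  · rw [hpt, hcen]; omega
  · intro i hij hbi
    rw [hcen, Finsupp.update_apply, if_neg hij, Finsupp.filter_apply, if_pos hbi]

/-! ### §4.2 The transfer inequality without condition (2) -/

/-- **THE TRANSFER WITHOUT CONDITION (2)** (every `q`): `x^r ∣ F`, condition (1), `ordAlong S F =
degIn S r + g`, `b` over the origin of the centre ⇒ **`d′_S + g ≤ d′_point + d`** (`φ : x_i ↦ x_j x_i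
(i ∉ S)`, `CentreBlowup.lift_step_F`, raises orders by `≥ Σ_{i∉S} r_i`; `|r′_point| = |r′_S| + Σ_{i∉S} r_i
+ (d − g)`); for `g = d` this is the tree's `CentreBlowup.shade_step_le_shade_pointStep`. [folklore] -/
theorem shade_step_add_le_shade_pointStep_add {q : ℕ} {S : Finset σ} {j : σ} (hj : j ∈ S)
    (b : σ → K) (hbj : b j = 0) (hbN : ∀ i, i ∉ S → b i = 0) (s : CState σ K) {o : ℕ}
    (ho : ordZero s.F = o) (hr : ∀ d ∈ s.F.support, s.r ≤ d)
    (hq : ∀ d ∈ s.F.support, q ≤ degIn S d) {g : ℕ}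
    (hg : ordAlong S s.F = ((degIn S s.r + g : ℕ) : ℕ∞)) :
    (step q S j b s).shade + (g : ℕ∞) ≤ (PointBlowup.step q j b s.toState).shade + s.shade := by
  have hφ := lift_step_F q hj b hbj hbN s hq
  obtain ⟨hdeg, hN⟩ := degree_step_r_transfer b hbj s ho hr hq hg
  by_cases ht : (step q S j b s).F = 0
  · have hpt : (PointBlowup.step q j b s.toState).F = 0 := by rw [← hφ, ht, map_zero]
    have h1 : (PointBlowup.step q j b s.toState).shade = ⊤ := by
      unfold PointBlowup.State.shade; rw [hpt, ordZero_zero, ENat.top_sub_coe]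
    rw [h1, top_add]
    exact le_top
  obtain ⟨oG, hoG⟩ := exists_ordZero_eq_natCast ht
  have hr1 := step_r_le_of_mem_support_step q S j b hbj s hr
  -- `φ` raises the order by at least `Σ_{i ∉ S} r_i = |r| − degIn S r`
  have hrN : ∀ e ∈ (step q S j b s).F.support, s.r.degree - degIn S s.r ≤ e.degree - degIn S e := by
    intro e he
    have hle := hr1 e he
    have h1 := degIn_add_sum_compl S e
    have h2 := degIn_add_sum_compl S s.r
    have h3 : ∑ i ∈ Sᶜ, s.r i ≤ ∑ i ∈ Sᶜ, e i := Finset.sum_le_sum fun i hi => by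
      have hi' : i ∉ S := Finset.mem_compl.mp hi
      have hij : i ≠ j := fun h => hi' (h ▸ hj)
      rw [← hN i hij (hbN i hi')]
      exact Finsupp.le_def.mp hle i
    omega
  have hlift := le_ordZero_lift S j (step q S j b s).F hoG hrN
  rw [hφ] at hlift
  -- the point-step residual polynomial is non-zero, of order `o₁ ≥ oG + Σ_{i∉S} r_i`
  have hpt0 : (PointBlowup.step q j b s.toState).F ≠ 0 := by
    rw [← hφ]
    exact lift_ne_zero hj ht
  obtain ⟨o₁, ho₁⟩ := exists_ordZero_eq_natCast hpt0
  rw [ho₁] at hlift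
  have hlift' : oG + (s.r.degree - degIn S s.r) ≤ o₁ := by exact_mod_cast hlift
  -- `|r′_S| ≤ oG` and `|r′_point| ≤ o₁`
  obtain ⟨⟨E₁, hE₁, hE₁deg⟩, -⟩ := (ordZero_eq_nat_iff _ _).mp hoG
  have hrle : (step q S j b s).r.degree ≤ oG :=
    hE₁deg ▸ PointBlowup.degree_le_degree_of_le (hr1 E₁ (MvPolynomial.mem_support_iff.mpr hE₁))
  obtain ⟨⟨E₂, hE₂, hE₂deg⟩, -⟩ := (ordZero_eq_nat_iff _ _).mp ho₁
  have hrle₂ : (PointBlowup.step q j b s.toState).r.degree ≤ o₁ :=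
    hE₂deg ▸ PointBlowup.degree_le_degree_of_le
      (PointBlowup.newMult_le_of_mem_support_step q j b hbj s.toState ho hr E₂
        (MvPolynomial.mem_support_iff.mpr hE₂))
  -- `|r| = degIn S r + Σ_{i∉S} r_i ≤ o`
  obtain ⟨⟨d₀, hd₀, hd₀deg⟩, -⟩ := (ordZero_eq_nat_iff _ _).mp ho
  have hro : s.r.degree ≤ o :=
    hd₀deg ▸ PointBlowup.degree_le_degree_of_le (hr d₀ (MvPolynomial.mem_support_iff.mpr hd₀))
  have hSle := degIn_le_degree S s.r
  rw [CState.shade_eq_of_ordZero_eq _ hoG, PointBlowup.shade_eq_of_ordZero_eq _ ho₁,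
    CState.shade_eq_of_ordZero_eq s ho]
  change (((oG - (step q S j b s).r.degree : ℕ) : ℕ∞) + (g : ℕ∞) ≤
    ((o₁ - (PointBlowup.step q j b s.toState).r.degree : ℕ) : ℕ∞) + ((o - s.r.degree : ℕ) : ℕ∞))
  exact_mod_cast (show oG - (step q S j b s).r.degree + g ≤
    (o₁ - (PointBlowup.step q j b s.toState).r.degree) + (o - s.r.degree) by omega)

end Transfer
/-! ### §4.3 Consequences at order `q = p^e` -/
section PrimePower

variable {σ : Type*} {K : Type*} [Field K] [Fintype σ] [DecidableEq σ] [DecidableEq K]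
variable (p : ℕ) [hp : Fact p.Prime] [CharP K p]

/-- **`d′ ≤ 2d − g + p^{e−1}` at EVERY point over the origin of a Hironaka-permissible coordinate centre**
(`q = p^e`, condition (1) only, clean `F`, `x^r ∣ F`; `b_j = 0`, `b = 0` off `S`): the transfer followed by
Moh's bound for the point step (`PointBlowup.mohBound`); the bound for PERM2-0 rises at translated points
(at the origin part 2 gives `2d − g`). [cite: Moh1987, Stability Theorem (one permissible blow-up), §1 Propositions 1–2]
[cite: HauserPerlega2019PRIMS, §3 Theorem (9)] -/
theorem shade_step_add_le_two_mul_add_pow {e : ℕ} (he : 1 ≤ e) {S : Finset σ} {j : σ} (hj : j ∈ S)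
    (b : σ → K) (hbj : b j = 0) (hbN : ∀ i, i ∉ S → b i = 0) (s : CState σ K)
    (hclean : deletePthPowers (p ^ e) s.F = s.F) {o : ℕ} (ho : ordZero s.F = o)
    (hr : ∀ d ∈ s.F.support, s.r ≤ d) (hq : ∀ d ∈ s.F.support, p ^ e ≤ degIn S d) {g : ℕ}
    (hg : ordAlong S s.F = ((degIn S s.r + g : ℕ) : ℕ∞)) :
    (step (p ^ e) S j b s).shade + (g : ℕ∞) ≤ 2 * s.shade + ((p ^ (e - 1) : ℕ) : ℕ∞) := by
  have hT := shade_step_add_le_shade_pointStep_add hj b hbj hbN s ho hr hq hg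
  have hord : ((p ^ e : ℕ) : ℕ∞) ≤ ordZero s.F := by
    obtain ⟨⟨d₀, hd₀, hd₀deg⟩, -⟩ := (ordZero_eq_nat_iff _ _).mp ho
    have h1 := hq d₀ (MvPolynomial.mem_support_iff.mpr hd₀)
    have h2 := degIn_le_degree S d₀
    rw [ho]
    exact_mod_cast (show p ^ e ≤ o by omega)
  have hM := PointBlowup.mohBound p he j b hbj s.toState hclean hord hr
  unfold PointBlowup.MohBound at hM
  have hs : s.toState.shade = s.shade := rfl
  rw [hs] at hM
  calc (step (p ^ e) S j b s).shade + (g : ℕ∞)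
      ≤ (PointBlowup.step (p ^ e) j b s.toState).shade + s.shade := hT
    _ ≤ (s.shade + ((p ^ (e - 1) : ℕ) : ℕ∞)) + s.shade := add_le_add hM le_rfl
    _ = 2 * s.shade + ((p ^ (e - 1) : ℕ) : ℕ∞) := by rw [two_mul]; abel

/-- **`d′ ≤ 2d − g` on LOSS-FREE edges at every point over the origin, every `q = p^e`** (condition (1)
ONLY — PERM2-0 allowed; `r_i ≠ 0 ⇒ b_i = 0`): the POINT step with the same chart and point cannot raise
the shade (a rise loses two components with `q ∤ r_i`, one translated: `PointBlowup.exists_two_lost_of_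
shadeIncreases`), and the transfer adds `d − g`. [cite: HauserPerlega2019PRIMS, §3 Comment (d)] -/
theorem shade_step_add_le_two_mul_of_lossFree {e : ℕ} (he : 1 ≤ e) {S : Finset σ} {j : σ}
    (hj : j ∈ S) (b : σ → K) (hbj : b j = 0) (hbN : ∀ i, i ∉ S → b i = 0) (s : CState σ K)
    (hloss : ∀ i, s.r i ≠ 0 → b i = 0) (hclean : deletePthPowers (p ^ e) s.F = s.F) {o : ℕ}
    (ho : ordZero s.F = o) (hr : ∀ d ∈ s.F.support, s.r ≤ d)
    (hq : ∀ d ∈ s.F.support, p ^ e ≤ degIn S d) {g : ℕ}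
    (hg : ordAlong S s.F = ((degIn S s.r + g : ℕ) : ℕ∞)) :
    (step (p ^ e) S j b s).shade + (g : ℕ∞) ≤ 2 * s.shade := by
  have hT := shade_step_add_le_shade_pointStep_add hj b hbj hbN s ho hr hq hg
  have hqo : p ^ e ≤ o := by
    obtain ⟨⟨d₀, hd₀, hd₀deg⟩, -⟩ := (ordZero_eq_nat_iff _ _).mp ho
    have h1 := hq d₀ (MvPolynomial.mem_support_iff.mpr hd₀)
    have h2 := degIn_le_degree S d₀
    omega
  have key : ∀ i, i ≠ j → (i = j ∨ b i ≠ 0) → ¬ p ^ e ∣ s.r i → False := fun i hij hor hndvd => by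
    have hbi : b i ≠ 0 := hor.resolve_left hij
    have hri : s.r i = 0 := by
      by_contra h
      exact hbi (hloss i h)
    rw [hri] at hndvd
    exact hndvd (dvd_zero _)
  have hpt : (PointBlowup.step (p ^ e) j b s.toState).shade ≤ s.shade := by
    by_contra hlt
    have hinc : PointBlowup.ShadeIncreases (p ^ e) j b s.toState := not_le.mp hlt
    obtain ⟨i₁, i₂, hne, h₁, h₂, hr₁, hr₂⟩ :=
      PointBlowup.exists_two_lost_of_shadeIncreases p he j b hbj s.toState hclean ho hqo hr hinc
    by_cases hi : i₁ = j
    · exact key i₂ (fun h => hne (hi.trans h.symm)) h₂ hr₂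
    · exact key i₁ hi h₁ hr₁
  calc (step (p ^ e) S j b s).shade + (g : ℕ∞)
      ≤ (PointBlowup.step (p ^ e) j b s.toState).shade + s.shade := hT
    _ ≤ s.shade + s.shade := add_le_add hpt le_rfl
    _ = 2 * s.shade := (two_mul _).symm

/-- **(1) ∧ (2) ∧ loss-free ⇒ `d′ ≤ d` at EVERY `q = p^e` and every point over the origin of the centre**:
a rise loses two components with `q ∤ r_i` (the tree's `CentreBlowup.exists_two_lost_of_shadeIncreases`),
one of them translated with `r_i ≠ 0`; part 2's `shade_step_le_of_lossFree` is `e = 1`.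
[cite: HauserPerlega2019PRIMS, §3 Comment (d)] -/
theorem shade_step_le_of_lossFree_pow {e : ℕ} (he : 1 ≤ e) {S : Finset σ} {j : σ} (hj : j ∈ S)
    (b : σ → K) (hbj : b j = 0) (hbN : ∀ i, i ∉ S → b i = 0) (s : CState σ K)
    (hloss : ∀ i, s.r i ≠ 0 → b i = 0) (hclean : deletePthPowers (p ^ e) s.F = s.F) {o : ℕ}
    (ho : ordZero s.F = o) (hr : ∀ d ∈ s.F.support, s.r ≤ d)
    (hq : ∀ d ∈ s.F.support, p ^ e ≤ degIn S d)
    (hperm : ∀ d ∈ s.F.support, degIn S s.r + (o - s.r.degree) ≤ degIn S d) :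
    (step (p ^ e) S j b s).shade ≤ s.shade := by
  by_contra hlt
  have hinc : ShadeIncreases (p ^ e) S j b s := not_le.mp hlt
  obtain ⟨i₁, i₂, hne, h₁, h₂, hr₁, hr₂⟩ :=
    CentreBlowup.exists_two_lost_of_shadeIncreases p he hj b hbj hbN s hclean ho hr hq hperm hinc
  have key : ∀ i, i ≠ j → (i = j ∨ b i ≠ 0) → ¬ p ^ e ∣ s.r i → False := fun i hij hor hndvd => by
    have hbi : b i ≠ 0 := hor.resolve_left hij
    have hri : s.r i = 0 := by
      by_contra h
      exact hbi (hloss i h)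
    rw [hri] at hndvd
    exact hndvd (dvd_zero _)
  by_cases hi : i₁ = j
  · exact key i₂ (fun h => hne (hi.trans h.symm)) h₂ hr₂
  · exact key i₁ hi h₁ hr₁

end PrimePower
end Perm2Bound
/-! ### §4.4 In the cell's vocabulary -/

section Cell
open Literature.AlgebraicGeometry.Resolution
open Literature.AlgebraicGeometry.Resolution.CentreBlowup
open Literature.AlgebraicGeometry.Resolution.Hauser2010
variable {K : Type} [Field K] [DecidableEq K] (p : ℕ) [Fact p.Prime] [CharP K p]

/-- **`d′ ≤ 2d − g + p^{e−1}` in the cell's letters** (`q = p^e`, `IsPermissibleCentre (p^e) S F`, point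
over the origin of the centre): `d′ + ordAlong S F ≤ 2d + degIn S r + p^{e−1}`. [OURS · about the candidate
frame] [cite: Moh1987, Stability Theorem (one permissible blow-up), §1 Propositions 1–2] -/
theorem shade_add_ordAlong_le_add_pow {e : ℕ} (he : 1 ≤ e) {S : Finset (Fin 4)} {j : Fin 4}
    (hj : j ∈ S) (b : Fin 4 → K) (hbj : b j = 0) (hbN : ∀ i, i ∉ S → b i = 0) (s : State K)
    (hclean : deletePthPowers (p ^ e) s.F = s.F) (hr : ∀ d ∈ s.F.support, s.r ≤ d)
    (hS : IsPermissibleCentre (p ^ e) S s.F) :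
    (CentreBlowup.step (p ^ e) S j b s).shade + ordAlong S s.F ≤
      2 * s.shade + degIn S s.r + ((p ^ (e - 1) : ℕ) : ℕ∞) := by
  by_cases hF : s.F = 0
  · have hsh : s.shade = ⊤ := by
      unfold CState.shade; rw [hF, ordZero_zero, ENat.top_sub_coe]
    rw [hsh, two_mul, top_add, top_add, top_add]
    exact le_top
  obtain ⟨o, ho⟩ := exists_ordZero_eq_natCast hF
  obtain ⟨g, hg⟩ := exists_ordAlong_eq_add S s hF hr
  have h := Perm2Bound.shade_step_add_le_two_mul_add_pow p he hj b hbj hbN s hclean ho hr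
    (forall_le_degIn_of_isPermissibleCentre hS) hg
  have e1 : (CentreBlowup.step (p ^ e) S j b s).shade + ordAlong S s.F =
      ((CentreBlowup.step (p ^ e) S j b s).shade + (g : ℕ∞)) + (degIn S s.r : ℕ∞) := by
    rw [hg, Nat.cast_add]; ring
  have e2 : 2 * s.shade + (degIn S s.r : ℕ∞) + ((p ^ (e - 1) : ℕ) : ℕ∞) =
      (2 * s.shade + ((p ^ (e - 1) : ℕ) : ℕ∞)) + (degIn S s.r : ℕ∞) := by ring
  rw [e1, e2]
  exact add_le_add h le_rfl

/-- **Moh's `+ p^{e−1}` in the cell's letters** (the tree's `CentreBlowup.mohBound_pow` over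
`IsPermissibleCentre (p^e) S F ∧ Perm2 S s`): `d′ ≤ d + p^{e−1}` at every point over the origin of the
centre. [OURS · about the candidate frame] [cite: Moh1987, Stability Theorem (one permissible blow-up), §1] -/
theorem shade_le_add_pow_of_perm2 {e : ℕ} (he : 1 ≤ e) {S : Finset (Fin 4)} {j : Fin 4}
    (hj : j ∈ S) (b : Fin 4 → K) (hbj : b j = 0) (hbN : ∀ i, i ∉ S → b i = 0) (s : State K)
    (hclean : deletePthPowers (p ^ e) s.F = s.F) (hr : ∀ d ∈ s.F.support, s.r ≤ d)
    (hS : IsPermissibleCentre (p ^ e) S s.F) (h2 : Perm2 S s) :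
    (CentreBlowup.step (p ^ e) S j b s).shade ≤ s.shade + ((p ^ (e - 1) : ℕ) : ℕ∞) := by
  by_cases hF : s.F = 0
  · have hsh : s.shade = ⊤ := by
      unfold CState.shade; rw [hF, ordZero_zero, ENat.top_sub_coe]
    rw [hsh, top_add]
    exact le_top
  obtain ⟨o, ho⟩ := exists_ordZero_eq_natCast hF
  exact CentreBlowup.mohBound_pow p he hj b hbj hbN s hclean ho hr
    (forall_le_degIn_of_isPermissibleCentre hS) ((perm2_iff_forall S s ho).mp h2)

/-- **`d′ ≤ 2d − g` on loss-free edges in the cell's letters (`q = p^e`)**: Hironaka-permissible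
centre, point over the origin of the centre losing no component of positive multiplicity: `d′ + ordAlong
S F ≤ 2d + degIn S r`. [OURS · about the candidate frame] [cite: HauserPerlega2019PRIMS, §3 Comment (d)] -/
theorem shade_add_ordAlong_le_of_lossFree {e : ℕ} (he : 1 ≤ e) {S : Finset (Fin 4)} {j : Fin 4}
    (hj : j ∈ S) (b : Fin 4 → K) (hbj : b j = 0) (hbN : ∀ i, i ∉ S → b i = 0) (s : State K)
    (hloss : ∀ i, s.r i ≠ 0 → b i = 0) (hclean : deletePthPowers (p ^ e) s.F = s.F)
    (hr : ∀ d ∈ s.F.support, s.r ≤ d) (hS : IsPermissibleCentre (p ^ e) S s.F) :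
    (CentreBlowup.step (p ^ e) S j b s).shade + ordAlong S s.F ≤ 2 * s.shade + degIn S s.r := by
  by_cases hF : s.F = 0
  · have hsh : s.shade = ⊤ := by
      unfold CState.shade; rw [hF, ordZero_zero, ENat.top_sub_coe]
    rw [hsh, two_mul, top_add, top_add]
    exact le_top
  obtain ⟨o, ho⟩ := exists_ordZero_eq_natCast hF
  obtain ⟨g, hg⟩ := exists_ordAlong_eq_add S s hF hr
  have h := Perm2Bound.shade_step_add_le_two_mul_of_lossFree p he hj b hbj hbN s hloss hclean ho hr
    (forall_le_degIn_of_isPermissibleCentre hS) hg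
  have e1 : (CentreBlowup.step (p ^ e) S j b s).shade + ordAlong S s.F =
      ((CentreBlowup.step (p ^ e) S j b s).shade + (g : ℕ∞)) + (degIn S s.r : ℕ∞) := by
    rw [hg, Nat.cast_add]; ring
  rw [e1]
  exact add_le_add h le_rfl

/-- **HP-permissible ∧ loss-free ⇒ not a RISE:d, every `q = p^e`** (cell's letters; part 2's
`not_riseD_of_perm2_of_lossFree` is `e = 1`). [OURS · about the candidate frame]
[cite: HauserPerlega2019PRIMS, §3 Comment (d)] -/
theorem not_riseD_of_perm2_of_lossFree_pow {e : ℕ} (he : 1 ≤ e) {S : Finset (Fin 4)} {j : Fin 4}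
    (hj : j ∈ S) (b : Fin 4 → K) (hbj : b j = 0) (hbN : ∀ i, i ∉ S → b i = 0) (s : State K)
    (hloss : ∀ i, s.r i ≠ 0 → b i = 0) (hclean : deletePthPowers (p ^ e) s.F = s.F)
    (hr : ∀ d ∈ s.F.support, s.r ≤ d) (hS : IsPermissibleCentre (p ^ e) S s.F) (h2 : Perm2 S s) :
    ¬ RiseD s (CentreBlowup.step (p ^ e) S j b s) := by
  unfold RiseD
  rw [not_lt]
  by_cases hF : s.F = 0
  · have : s.shade = ⊤ := by
      unfold CState.shade; rw [hF, ordZero_zero, ENat.top_sub_coe]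
    rw [this]; exact le_top
  obtain ⟨o, ho⟩ := exists_ordZero_eq_natCast hF
  exact Perm2Bound.shade_step_le_of_lossFree_pow p he hj b hbj hbN s hloss hclean ho hr
    (forall_le_degIn_of_isPermissibleCentre hS) ((perm2_iff_forall S s ho).mp h2)

end Cell

end Summit.ResolutionOfSingularities.ResolutionOfSingularities.Theorems.PIDim4

end
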